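import Summits.QuantumFields.YangMills.Theorems.BalabanUVNodesN22WindowedNE9OfStripSchemas
import Literature.MathematicalPhysics.QuantumFieldTheory.Balaban1983to89.B12Display286RightMember

/-!
# BalabanUVNodes ∕ node N22 = NE9 — MODULI-DOMINATION AUDIT: a (β′) table that is UNIFORM in the age of the coupling cannot be dominated by the
# record's GEOMETRIC history moduli `ℓ.moduli n i = C₉·ω^{n−i}` (`ω < 1`); the junction row `hdom` of the at-record editions is either vacuous
# modulo degenerate data (uniform tables) or forces AGE-GROWING coupling radii (margin tables)

Cell `pub-ymgap`, HUMAN RULING D-0062 (Track A), R134 seat `pub-ymgap-dag-n22-c` (strategy s1), generation 14, module J37.  THEOREMS ONLY (no `def`, no `sorry`,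
standard axioms); `--kind proof --supports stmt-QuantumFields-20544 --as helper` (K3⁷ `SpineGivenEndpointR13SepCoPH`, skeleton v5 941dddb108cb), COUNT-NEUTRAL.
An AUTHOR-SIDE located finding on the COMPOSITION of this seat's own J35 (`…N22WindowedNE9OfStripSchemas`, p615191 ∕ p618510) with node00-def-RR-1's letter block
at the record (dag-n22-w5's `…N22AtRecordOfStepSchemas` §2, p618341) — kernel facts, so that referees and the plan can cite them.

WHY.  K3⁷ v5 §2b's N22 input is `h9 : NE9 ((objectsOfRecord₁₃ F 2 θ ℓ).EA 0) (Window θ.γ) ℓ.κ ℓ.moduli` with the HISTORY MODULI OF RECORD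
`ℓ.moduli n i = ℓ.C₉ · ℓ.ω ^ (n − i)` (`U3Letters₁₁.moduli`) under the letter signs `ℓ.Signs` (`0 ≤ ℓ.ω < 1`, `0 ≤ ℓ.C₉`): GENUINE fading memory.  Every
holomorphy road of this lane (J31 ∕ J32′ ∕ J33 ∕ J34 ∕ J35) concludes `WindowedNE9 F (localizedSum F S emb) … (C·table)` with a table that is either UNIFORM in the age
`n − i` (J35: `C·4E₀∕r_E` from the strip schemas' uniform letters) or parametrised by coupling-holomorphy RADII (J34: `C·4B∕ρt n i`; J33's older branch:
`C·c₀·4A∕ϱt n i`); the at-record editions junction the table into `ℓ.moduli` through a row `hdom : ∀ n i, C·table n i ≤ ℓ.moduli n i`.  THIS FILE records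
what that row costs:
* §1 `le_zero_of_forall_le_geometric` ∕ `le_zero_of_forall_le_moduli` — a real number below `C₉·ω^n` for every `n` (`ω < 1`) is `≤ 0`; so a table entry that does
  NOT depend on the age can be dominated by `ℓ.moduli` only if it is `≤ 0`.
* §2 THE UNIFORM TABLE (J35 at the record, p618341 §2): `hdom ∧ ℓ.Signs ⇒ 16B₃²∕r²·e^{12Mδ₁}K₀K₁·E₀ ≤ 0` (`uniformTable_const_mul_E₀_nonpos`), whence
  `B₃ = 0 ∨ E₀ ≤ 0` (`degenerate_of_uniformTable_le_moduli`, using `K₁(4, δ₀∕2) ≥ 1` — `B12Display286RightMember.one_le_K₁` BY NAME); with the site-weight tails non-trivial (`0 < B₃`) and the renewal row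
  `e·9·64·K₀²·C₃ε₁ ≤ E₀`, `0 ≤ C₃ε₁`: `E₀ = 0 ∧ C₃ε₁ = 0` (`E₀_eq_zero_of_uniformTable_le_moduli`) — and an `EHoloAt` witness with `H.E₀ ≤ 0` forces the sf-tower's
  new term to VANISH identically on `[0, γ]` (`sfTower_E_eq_zero_of_eHoloAt_nonpos`): the composition is VACUOUS MODULO DEGENERATE DATA (zero weights or zero towers).
  J35 itself (uniform-moduli conclusion) is not affected; the vacuity enters at the `ℓ.moduli` junction only.
* §3 THE MARGIN TABLES (J34 ∕ J33 at the record): `hdom ∧ ℓ.Signs ∧ 0 < B` ⇒ `C·4B ≤ ℓ.C₉·ℓ.ω^{n−i}·ρt n i` for all `n, i`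
  (`radii_ge_of_marginTable_le_moduli`), so `0 < ℓ.ω`, `0 < ℓ.C₉` and the radii GROW GEOMETRICALLY WITH THE AGE: `ρt n i → ∞` as `n → ∞` at fixed `i`
  (`radii_tendsto_atTop_of_marginTable_le_moduli`).  As abstract hypotheses these are satisfiable (dag-n22-w1's «fading memory from age-growing radii» road); the
  located remark (NOT a kernel fact): at Bałaban's objects a step term is holomorphic in an OLD coupling `g_i ∈ ]0, γ]` on pencils ∕ relative discs about the positive
  axis only ([I] p. 263 «(or analytic)»; the step-`i` small-field characteristic functions read `g_i`), so radii `≫ γ` are not available there.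
CONSEQUENCE (the repair, module J38 `…N22KernelFadingOfStepRate`): the geometric gain must be GENUINE — it is node N18's kernel step rate (tower-NE5) read through
dag-n22-a's discrete Landau–Kolmogorov knit, with UNIFORM second differences in each young coupling; no uniform-in-age table is asked to dominate `ℓ.moduli` there.

HONEST FRAMING (binding).  Count-neutral kernel arithmetic over DISPLAYED hypothesis rows of landed at-record compositions; NO estimate of Bałaban's is proved or
asserted; nothing of the record is constructed; N22 is NOT discharged (typed 28∕28 · discharged 5∕27 UNCHANGED); K3⁷ OPEN and NOT claimed; NE9 is NOT IN PRINT for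
d = 4; no count claim; one finite 𝕋⁴ programme at fixed ε — R4 closes the CONDITIONAL rung `BalabanLadder.UV` only; NOTHING about the continuum limit, ℝ⁴, infinite
volume, OS axioms, a mass gap or the Clay problem is proved or claimed.  References (TYPES only, no cite tags on the Summit side): [I] = Bałaban, CMP 109 (1987)
(1.18) p. 263, (1.20)–(1.22) p. 264, (5.10) p. 293; [II] = CMP 116 (1988) (2.13)–(2.14) pp. 14–15.
-/

noncomputable section

open Filter Topology Metric Set
open scoped BigOperators

namespace YMDAG.N22.ModuliAudit

open Literature.MathematicalPhysics.QuantumFieldTheory.Balaban1983to89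
open Literature.MathematicalPhysics.QuantumFieldTheory.Balaban1983to89.B12TreeDecay (K₀ K₀_pos)
open Literature.MathematicalPhysics.QuantumFieldTheory.Balaban1983to89.B12Decay510 (delta1)
open Literature.MathematicalPhysics.QuantumFieldTheory.Balaban1983to89.B12Decay510Window (K₁ K₁_nonneg)
open Literature.MathematicalPhysics.QuantumFieldTheory.Balaban1983to89.B12Display286RightMember (one_le_K₁)
open Literature.MathematicalPhysics.QuantumFieldTheory.Balaban1983to89.B12BetaHolo (EHoloAt)
open Literature.MathematicalPhysics.QuantumFieldTheory.Balaban1983to89.Step (SFConsts SFTower)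
open Literature.MathematicalPhysics.QuantumFieldTheory.Balaban1983to89.Node00 (U3Letters₁₁)

/-! ## §1 A constant below a geometric sequence of ratio `< 1` is nonpositive -/

/-- **REAL ARITHMETIC**: `T ≤ C·ω^n` for every `n`, with `0 ≤ ω < 1`, forces `T ≤ 0`. [folklore] -/
theorem le_zero_of_forall_le_geometric {T C ω : ℝ} (hω0 : 0 ≤ ω) (hω1 : ω < 1) (h : ∀ n : ℕ, T ≤ C * ω ^ n) : T ≤ 0 := by
  have ht : Tendsto (fun n : ℕ => C * ω ^ n) atTop (𝓝 (C * 0)) :=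
    (tendsto_pow_atTop_nhds_zero_of_lt_one hω0 hω1).const_mul C
  rw [mul_zero] at ht
  exact ge_of_tendsto ht (Eventually.of_forall h)

/-- **THE RECORD's MODULI DOMINATE NO POSITIVE CONSTANT**: under the letter signs `ℓ.Signs` (`0 ≤ ℓ.ω < 1`), a real `T` with `T ≤ ℓ.moduli n i` for all `n, i`
(`ℓ.moduli n i = ℓ.C₉·ℓ.ω^{n−i}`) is `≤ 0` — read the row at `i = 0`, `n → ∞`. [folklore] -/
theorem le_zero_of_forall_le_moduli (ℓ : U3Letters₁₁) (hs : ℓ.Signs) {T : ℝ} (h : ∀ n i : ℕ, T ≤ ℓ.moduli n i) : T ≤ 0 :=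
  le_zero_of_forall_le_geometric hs.ω_nonneg hs.ω_lt_one fun n => by
    have := h n 0
    rwa [U3Letters₁₁.moduli_apply, Nat.sub_zero] at this

/-- The same with the row displayed only for `i ≤ n` (the history range). [folklore] -/
theorem le_zero_of_forall_le_moduli_of_le (ℓ : U3Letters₁₁) (hs : ℓ.Signs) {T : ℝ} (h : ∀ n i : ℕ, i ≤ n → T ≤ ℓ.moduli n i) : T ≤ 0 :=
  le_zero_of_forall_le_geometric hs.ω_nonneg hs.ω_lt_one fun n => by
    have := h n 0 (Nat.zero_le n)
    rwa [U3Letters₁₁.moduli_apply, Nat.sub_zero] at this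

/-! ## §2 The UNIFORM table (J35 at the record, p618341 §2): vacuity modulo degenerate data -/

/-- **THE UNIFORM TABLE's CONSTANT TIMES `E₀` IS NONPOSITIVE under `hdom`.**  The row `hdom` of p618341 §2 VERBATIM (`ℓ.Signs`, `0 < r_E`): the age-independent entry
`16B₃²∕r²·e^{3·4M·δ₁}·K₀(64,8)·K₁(4,δ₀∕2)·(4E₀∕r_E)` is `≤ 0`, hence so is `16B₃²∕r²·e^{…}·K₀·K₁·E₀`. [folklore] -/
theorem uniformTable_const_mul_E₀_nonpos (ℓ : U3Letters₁₁) (hs : ℓ.Signs) {B₃ r E₀ rE δ₀ κw : ℝ} {M : ℕ} (hrE : 0 < rE)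
    (hdom : ∀ n i, 16 * B₃ ^ 2 / r ^ 2 * Real.exp (delta1 δ₀ κw ((M : ℝ) * 4) * ((M : ℝ) * 4) * 3) * K₀ (4 * 2 ^ 4) (2 * 4) * K₁ 4 (δ₀ / 2) *
        (4 * E₀ / rE) ≤ ℓ.moduli n i) :
    16 * B₃ ^ 2 / r ^ 2 * Real.exp (delta1 δ₀ κw ((M : ℝ) * 4) * ((M : ℝ) * 4) * 3) * K₀ (4 * 2 ^ 4) (2 * 4) * K₁ 4 (δ₀ / 2) * E₀ ≤ 0 := by
  have h := le_zero_of_forall_le_moduli ℓ hs hdom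
  have hC : 0 ≤ 16 * B₃ ^ 2 / r ^ 2 * Real.exp (delta1 δ₀ κw ((M : ℝ) * 4) * ((M : ℝ) * 4) * 3) * K₀ (4 * 2 ^ 4) (2 * 4) * K₁ 4 (δ₀ / 2) := by
    have := K₀_pos (4 * 2 ^ 4) (2 * 4); have := K₁_nonneg 4 (δ₀ / 2); positivity
  have e : 16 * B₃ ^ 2 / r ^ 2 * Real.exp (delta1 δ₀ κw ((M : ℝ) * 4) * ((M : ℝ) * 4) * 3) * K₀ (4 * 2 ^ 4) (2 * 4) * K₁ 4 (δ₀ / 2) * (4 * E₀ / rE) =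
      (16 * B₃ ^ 2 / r ^ 2 * Real.exp (delta1 δ₀ κw ((M : ℝ) * 4) * ((M : ℝ) * 4) * 3) * K₀ (4 * 2 ^ 4) (2 * 4) * K₁ 4 (δ₀ / 2) * E₀) * (4 / rE) := by
    ring
  rw [e] at h
  have h4 : 0 < 4 / rE := by positivity
  nlinarith

/-- ★ **THE UNIFORM TABLE: `hdom ∧ ℓ.Signs ⇒ B₃ = 0 ∨ E₀ ≤ 0`** (`0 < r`, `0 < r_E`, `0 < δ₀`) — the row can hold only with vanishing site-weight tails (`B₃ = 0`: then `hw`, `htail` kill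
the reading's one-site differentials) or with a nonpositive uniform output letter `E₀`.  This is the junction of J35's uniform table with the record's geometric moduli
in dag-n22-w5's `ne9_EA_objectsOfRecord₁₃_of_stripSchemas` ∕ `n22At_rateCarriers_of_kernels_pin_of_stripSchemas` (p618341 §2), hypotheses VERBATIM. [folklore] -/
theorem degenerate_of_uniformTable_le_moduli (ℓ : U3Letters₁₁) (hs : ℓ.Signs) {B₃ r E₀ rE δ₀ κw : ℝ} {M : ℕ} (hr : 0 < r) (hrE : 0 < rE) (hδ₀ : 0 < δ₀)
    (hdom : ∀ n i, 16 * B₃ ^ 2 / r ^ 2 * Real.exp (delta1 δ₀ κw ((M : ℝ) * 4) * ((M : ℝ) * 4) * 3) * K₀ (4 * 2 ^ 4) (2 * 4) * K₁ 4 (δ₀ / 2) *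
        (4 * E₀ / rE) ≤ ℓ.moduli n i) :
    B₃ = 0 ∨ E₀ ≤ 0 := by
  have h := uniformTable_const_mul_E₀_nonpos ℓ hs hrE hdom
  by_cases hB : B₃ = 0
  · exact Or.inl hB
  · right
    have hC : 0 < 16 * B₃ ^ 2 / r ^ 2 * Real.exp (delta1 δ₀ κw ((M : ℝ) * 4) * ((M : ℝ) * 4) * 3) * K₀ (4 * 2 ^ 4) (2 * 4) * K₁ 4 (δ₀ / 2) := by
      have := K₀_pos (4 * 2 ^ 4) (2 * 4)
      have : 0 < K₁ 4 (δ₀ / 2) := lt_of_lt_of_le one_pos (one_le_K₁ 4 (half_pos hδ₀))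
      have : 0 < B₃ ^ 2 := by positivity
      positivity
    by_contra hE
    have hE' : 0 < E₀ := lt_of_not_ge hE
    have := mul_pos hC hE'
    linarith

/-- ★ **WITH NON-TRIVIAL TAILS AND THE RENEWAL ROW: `E₀ = 0 ∧ C₃ε₁ = 0`.**  p618341 §2's rows `hrenew : e·9·64·K₀(64,8)²·(C₃ε₁) ≤ E₀`, `hA0 : 0 ≤ C₃ε₁` VERBATIM and `0 < B₃`:
the uniform output letter AND Lemma 3's activity letter `C₃ε₁` of the S25 clauses both vanish. [folklore] -/
theorem E₀_eq_zero_of_uniformTable_le_moduli (ℓ : U3Letters₁₁) (hs : ℓ.Signs) {B₃ r E₀ rE δ₀ κw : ℝ} {M : ℕ} (c : B13.Consts) (hr : 0 < r) (hrE : 0 < rE)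
    (hδ₀ : 0 < δ₀) (hB₃ : 0 < B₃) (hA0 : 0 ≤ c.C3act * c.ε₁) (hrenew : Real.exp 1 * 9 * 64 * K₀ 64 8 ^ 2 * (c.C3act * c.ε₁) ≤ E₀)
    (hdom : ∀ n i, 16 * B₃ ^ 2 / r ^ 2 * Real.exp (delta1 δ₀ κw ((M : ℝ) * 4) * ((M : ℝ) * 4) * 3) * K₀ (4 * 2 ^ 4) (2 * 4) * K₁ 4 (δ₀ / 2) *
        (4 * E₀ / rE) ≤ ℓ.moduli n i) :
    E₀ = 0 ∧ c.C3act * c.ε₁ = 0 := by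
  have hK : 0 < K₀ 64 8 := K₀_pos 64 8
  have hlow : 0 ≤ Real.exp 1 * 9 * 64 * K₀ 64 8 ^ 2 * (c.C3act * c.ε₁) := by positivity
  have hE₀ : E₀ ≤ 0 := by
    rcases degenerate_of_uniformTable_le_moduli ℓ hs hr hrE hδ₀ hdom with h | h
    · exact absurd h hB₃.ne'
    · exact h
  have hE : E₀ = 0 := le_antisymm hE₀ (hlow.trans hrenew)
  refine ⟨hE, le_antisymm ?_ hA0⟩
  have h1 : Real.exp 1 * 9 * 64 * K₀ 64 8 ^ 2 * (c.C3act * c.ε₁) ≤ 0 := hE ▸ hrenew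
  have h2 : 0 < Real.exp 1 * 9 * 64 * K₀ 64 8 ^ 2 := by positivity
  nlinarith

/-- ★ **AN `EHoloAt` WITNESS WITH `H.E₀ ≤ 0` IS A ZERO TERM**: its (1.18)-on-`U` bound `‖Ec X φ g‖ ≤ H.E₀·e^{−κd}` kills the holomorphic extension on `U ⊇ [0, γ]`, so the tower's
new term `T.E (k+1) X t φ` VANISHES for every `t ∈ [0, γ]` and every configuration of the space — what p618341 §2's `hE` delivers once `E₀ = 0` (zero towers).
[folklore] -/
theorem sfTower_E_eq_zero_of_eHoloAt_nonpos {P : Params} {G : Type*} [GaugeGroup G] {Φ 𝒢 : Type*} {T : SFTower P G Φ 𝒢} {c : SFConsts} {k : ℕ} (H : EHoloAt T c k) (hE : H.E₀ ≤ 0)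
    (X : (T.sys (k + 1)).Dom) (φ : Φ) (hφ : φ ∈ T.space (k + 1) X c.α₀ c.α₁) {t : ℝ} (ht : t ∈ Icc (0 : ℝ) c.γ) :
    T.E (k + 1) X t φ = 0 := by
  have hmem : (t : ℂ) ∈ H.U := H.ball_subset t ht (mem_closedBall_self H.r_pos.le)
  have hb := H.bound X φ hφ (t : ℂ) hmem
  have h0 : ‖H.Ec X φ t‖ ≤ 0 := hb.trans (mul_nonpos_of_nonpos_of_nonneg hE (Real.exp_nonneg _))
  have hz : H.Ec X φ t = 0 := norm_le_zero_iff.1 h0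
  rw [H.eq X φ hφ t ht, hz]

/-- The family form: under p618341 §2's `hE` with a nonpositive uniform letter `E₀ ≤ 0`, EVERY new term of EVERY sf-tower of the family vanishes on `[0, cs.γ]` at the
configurations of its space — the zero towers. [folklore] -/
theorem sfTower_E_eq_zero_of_eHoloAt_family {P : Params} {G : Type*} [GaugeGroup G] {Φ 𝒢 : Type*} {ι : Type*} (T : ι → SFTower P G Φ 𝒢) {cs : SFConsts} {E₀ rE : ℝ} (hE₀ : E₀ ≤ 0)
    (hE : ∀ (a : ι) (k : ℕ), ∃ H : EHoloAt (T a) cs k, H.E₀ ≤ E₀ ∧ rE ≤ H.r) (a : ι) (k : ℕ)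
    (X : ((T a).sys (k + 1)).Dom) (φ : Φ) (hφ : φ ∈ (T a).space (k + 1) X cs.α₀ cs.α₁) {t : ℝ} (ht : t ∈ Icc (0 : ℝ) cs.γ) :
    (T a).E (k + 1) X t φ = 0 := by
  obtain ⟨H, hH, -⟩ := hE a k
  exact sfTower_E_eq_zero_of_eHoloAt_nonpos H (hH.trans hE₀) X φ hφ ht

/-! ## §3 The MARGIN tables (J34 ∕ J33 at the record): the radii must grow geometrically with the age -/

/-- ★ **A MARGIN TABLE DOMINATED BY THE RECORD's MODULI HAS AGE-GROWING RADII**: if `C·(4B∕ρt n i) ≤ ℓ.C₉·ℓ.ω^{n−i}` for all `n, i` with `0 < C`, `0 < B`, positive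
radii and `ℓ.Signs`, then `C·4B ≤ ℓ.C₉·ℓ.ω^{n−i}·ρt n i` — the radius at age `n − i` is at least `(4BC∕C₉)·ω^{−(n−i)}`.  (J34-at-record's `hdom` with
`C = 16B₃²∕r²·e^{12Mδ₁}K₀K₁`; J33-at-record's older branch likewise with `c₀·4A∕ϱt`.) [folklore] -/
theorem radii_ge_of_marginTable_le_moduli (ℓ : U3Letters₁₁) {C B : ℝ} {ρt : ℕ → ℕ → ℝ} (hρ : ∀ n i, 0 < ρt n i)
    (hdom : ∀ n i, C * (4 * B / ρt n i) ≤ ℓ.moduli n i) (n i : ℕ) :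
    C * (4 * B) ≤ ℓ.C₉ * ℓ.ω ^ (n - i) * ρt n i := by
  have h := hdom n i
  rw [U3Letters₁₁.moduli_apply] at h
  have hρ' := hρ n i
  have e : C * (4 * B / ρt n i) = C * (4 * B) / ρt n i := by ring
  rw [e, div_le_iff₀ hρ'] at h
  exact h

/-- Under such a row (with `0 < C`, `0 < B`) the fading letters are non-degenerate: `0 < ℓ.C₉` and `0 < ℓ.ω`. [folklore] -/
theorem letters_pos_of_marginTable_le_moduli (ℓ : U3Letters₁₁) (hs : ℓ.Signs) {C B : ℝ} {ρt : ℕ → ℕ → ℝ} (hC : 0 < C) (hB : 0 < B)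
    (hρ : ∀ n i, 0 < ρt n i) (hdom : ∀ n i, C * (4 * B / ρt n i) ≤ ℓ.moduli n i) :
    0 < ℓ.C₉ ∧ 0 < ℓ.ω := by
  have h1 := radii_ge_of_marginTable_le_moduli ℓ hρ hdom 1 0
  rw [Nat.sub_zero, pow_one] at h1
  have hCB : 0 < C * (4 * B) := by positivity
  have hprod : 0 < ℓ.C₉ * ℓ.ω * ρt 1 0 := lt_of_lt_of_le hCB h1
  have hCω : 0 < ℓ.C₉ * ℓ.ω := by
    by_contra h
    have h' : ℓ.C₉ * ℓ.ω ≤ 0 := le_of_not_gt h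
    have : ℓ.C₉ * ℓ.ω * ρt 1 0 ≤ 0 := mul_nonpos_iff.2 (Or.inr ⟨h', (hρ 1 0).le⟩)
    linarith
  rcases mul_pos_iff.1 hCω with ⟨hC₉, hω⟩ | ⟨hC₉, _⟩
  · exact ⟨hC₉, hω⟩
  · exact absurd hs.C₉_nonneg (not_le.2 hC₉)

/-- ★ **… AND THE RADII TEND TO INFINITY WITH THE AGE**: at every fixed coordinate `i`, `ρt n i → ∞` as `n → ∞` (`ω < 1`).  Holomorphy radii in an OLD coupling growing beyond
every bound is the content the row transfers to the margin datum (dag-n22-w1's radii road); the located remark of the header says why Bałaban's objects do not supply it. [folklore] -/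
theorem radii_tendsto_atTop_of_marginTable_le_moduli (ℓ : U3Letters₁₁) (hs : ℓ.Signs) {C B : ℝ} {ρt : ℕ → ℕ → ℝ} (hC : 0 < C) (hB : 0 < B)
    (hρ : ∀ n i, 0 < ρt n i) (hdom : ∀ n i, C * (4 * B / ρt n i) ≤ ℓ.moduli n i) (i : ℕ) :
    Tendsto (fun n => ρt n i) atTop atTop := by
  obtain ⟨hC₉, hω⟩ := letters_pos_of_marginTable_le_moduli ℓ hs hC hB hρ hdom
  have hCB : 0 < C * (4 * B) := by positivity
  -- `ρt n i ≥ (C·4B∕C₉) · (ω⁻¹)^{n−i}` and `ω⁻¹ > 1`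
  have hlow : ∀ n, C * (4 * B) / ℓ.C₉ * (ℓ.ω⁻¹) ^ (n - i) ≤ ρt n i := by
    intro n
    have h := radii_ge_of_marginTable_le_moduli ℓ hρ hdom n i
    have hωn : 0 < ℓ.ω ^ (n - i) := pow_pos hω _
    rw [inv_pow, ← div_eq_mul_inv, div_le_iff₀ hωn, div_le_iff₀ hC₉]
    calc C * (4 * B) ≤ ℓ.C₉ * ℓ.ω ^ (n - i) * ρt n i := h
      _ = ρt n i * ℓ.ω ^ (n - i) * ℓ.C₉ := by ring
  have hgt : 1 < ℓ.ω⁻¹ := one_lt_inv₀ hω |>.2 hs.ω_lt_one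
  have hgeo : Tendsto (fun n : ℕ => C * (4 * B) / ℓ.C₉ * (ℓ.ω⁻¹) ^ (n - i)) atTop atTop := by
    refine Tendsto.const_mul_atTop (div_pos hCB hC₉) ?_
    exact (tendsto_pow_atTop_atTop_of_one_lt hgt).comp (tendsto_sub_atTop_nat i)
  exact tendsto_atTop_mono hlow hgeo

end YMDAG.N22.ModuliAudit

end
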